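import Mathlib
import Summits.Ventures.HodgeRepro2.T5SmoothDoubleDual

/-!
# The smooth dual of an irreducible admissible representation is irreducible

Blind cell `pub-hodge-repro2`, seat p8 (gen 8), Tier-5 kernel support.  With the smooth dual
`π̃ = smoothDualRep ρ` (T5-59) and the level bookkeeping of `T5SmoothDoubleDual` (T5-60), the
classical sentence «`π` irreducible smooth admissible ⇒ `π̃` irreducible» is recorded for Mathlib's
`Representation.IsIrreducible`:

* `levelAverage_mem_of_mem` — a subrepresentation is stable under the level projectors `e_K`;
* `ann ρ W` — the annihilator in `V` of a subrepresentation `W ≤ π̃`; it is a subrepresentation of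
  `ρ` (`annSub`); `eq_bot_of_ann_eq_top` (`ann W = V ⇒ W = 0`) and `eq_top_of_ann_eq_bot`
  (`ann W = 0 ⇒ W = π̃`: a smooth functional `a` is `K`-fixed for some `K ∈ 𝒦`, `W^K` is a subspace
  of `(π̃)^K ≅ (π^K)^*`; were it proper, a non-zero `x ∈ π^K` would be killed by `W^K`, hence — through
  `e_K` — by all of `W`, so `x ∈ ann W = 0`);
* `isIrreducible_smoothDualRep` — THE THEOREM, for `ρ` irreducible, smooth, admissible along a family
  `𝒦` of compact open subgroups cofinal among the open subgroups, characteristic `0`;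
* `doubleDualRepEquiv` / `toDoubleDualIntertwining` — T5-60's `π ≅ π̃̃` packaged as Mathlib's
  `Representation.Equiv` / `Representation.IntertwiningMap`.

README §8(d): uses an L-value-free non-vanishing device: NO.
-/

namespace Summit.Ventures.HodgeRepro2.T5SmoothDualIrreducible

noncomputable section

open Summit.Ventures.HodgeRepro2.LevelPositivity
open Summit.Ventures.HodgeRepro2.T5LevelIdempotent
open Summit.Ventures.HodgeRepro2.T5LevelIdempotentDual
open Summit.Ventures.HodgeRepro2.T5AdmissibleTransfer
open Summit.Ventures.HodgeRepro2.T5SmoothDual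
open Summit.Ventures.HodgeRepro2.T5SmoothDualRep
open Summit.Ventures.HodgeRepro2.T5SmoothDualRep.SmoothDualSpace
open Summit.Ventures.HodgeRepro2.T5SmoothDoubleDual

variable {G : Type*} [Group G] [TopologicalSpace G] [IsTopologicalGroup G]
  {k : Type*} [Field k] {V : Type*} [AddCommGroup V] [Module k V]

section Subrep

variable {W₀ : Type*} [AddCommGroup W₀] [Module k W₀] (σ : Representation k G W₀)

omit [TopologicalSpace G] [IsTopologicalGroup G] in
/-- A subrepresentation is stable under the level projector `e_K` (characteristic `0`). -/
theorem levelAverage_mem_of_mem [CharZero k] (W' : Subrepresentation σ) {K : Subgroup G} {w : W₀}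
    (hw : w ∈ W') [(stabilizerIn σ K w).FiniteIndex] : levelAverage σ K w ∈ W' := by
  have h0 : ((stabilizerIn σ K w).index : k) ≠ 0 :=
    Nat.cast_ne_zero.2 Subgroup.FiniteIndex.index_ne_zero
  rw [levelAverage_eq (le_refl _) h0]
  apply W'.toSubmodule.smul_mem
  unfold cosetSum
  refine finsum_induction (fun x => x ∈ W'.toSubmodule) W'.toSubmodule.zero_mem
    (fun x y hx hy => W'.toSubmodule.add_mem hx hy) ?_
  intro c
  exact W'.apply_mem_toSubmodule _ hw

end Subrep

section Annihilator

variable (ρ : Representation k G V)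

/-- The annihilator in `V` of a subrepresentation `W` of the smooth dual. -/
def ann (W : Subrepresentation (smoothDualRep ρ)) : Submodule k V where
  carrier := {v | ∀ w ∈ W, ((w : SmoothDualSpace ρ).val : Module.Dual k V) v = 0}
  add_mem' {v v'} hv hv' w hw := by rw [map_add, hv w hw, hv' w hw, add_zero]
  zero_mem' w _ := map_zero _
  smul_mem' c v hv w hw := by rw [map_smul, hv w hw, smul_zero]

/-- Membership in `ann`. -/
theorem mem_ann_iff {W : Subrepresentation (smoothDualRep ρ)} {v : V} :
    v ∈ ann ρ W ↔ ∀ w ∈ W, ((w : SmoothDualSpace ρ).val : Module.Dual k V) v = 0 := Iff.rfl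

/-- `ann W` is `G`-stable. -/
theorem apply_mem_ann (W : Subrepresentation (smoothDualRep ρ)) (g : G) {v : V} (hv : v ∈ ann ρ W) :
    ρ g v ∈ ann ρ W := by
  intro w hw
  have h := hv (smoothDualRep ρ g⁻¹ w) (W.apply_mem_toSubmodule g⁻¹ hw)
  rw [coe_smoothDualRep_val, Representation.dual_apply, Module.Dual.transpose_apply,
    LinearMap.comp_apply, inv_inv] at h
  exact h

/-- `ann W` as a subrepresentation of `ρ`. -/
def annSub (W : Subrepresentation (smoothDualRep ρ)) : Subrepresentation ρ :=
  ⟨ann ρ W, fun g _ hv => apply_mem_ann ρ W g hv⟩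

/-- `ann W = V ⇒ W = 0`. -/
theorem eq_bot_of_ann_eq_top (W : Subrepresentation (smoothDualRep ρ)) (h : ann ρ W = ⊤) : W = ⊥ := by
  apply Subrepresentation.toSubmodule_injective
  show W.toSubmodule = ⊥
  rw [eq_bot_iff]
  intro w hw
  rw [Submodule.mem_bot]
  apply SmoothDualSpace.ext
  apply Subtype.ext
  ext v
  have hv : v ∈ ann ρ W := h ▸ Submodule.mem_top
  exact hv w hw

variable [CharZero k]

/-- `ann W = 0 ⇒ W = π̃` for smooth admissible `ρ` (`𝒦` compact open, cofinal among the open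
subgroups). -/
theorem eq_top_of_ann_eq_bot (hρ : IsSmooth ρ) {𝒦 : Set (Subgroup G)}
    (hopen : ∀ K ∈ 𝒦, IsOpen (K : Set G)) (hcpt : ∀ K ∈ 𝒦, IsCompact (K : Set G))
    (hbasis : ∀ U : Subgroup G, IsOpen (U : Set G) → ∃ K ∈ 𝒦, K ≤ U) (hadm : IsAdmissible ρ 𝒦)
    (W : Subrepresentation (smoothDualRep ρ)) (h : ann ρ W = ⊥) : W = ⊤ := by
  apply Subrepresentation.toSubmodule_injective
  show W.toSubmodule = ⊤
  rw [eq_top_iff]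
  intro a _
  obtain ⟨K, hK, hKle⟩ := hbasis _ a.val.2
  have ha : a ∈ invariants (smoothDualRep ρ) K := by
    rw [mem_invariants_iff]
    intro g hg
    apply SmoothDualSpace.ext
    apply Subtype.ext
    exact mem_stabilizer_iff.mp (hKle hg)
  have hKf : KFinite ρ K := kFinite_of_isSmooth hρ (hcpt K hK)
  haveI : FiniteDimensional k (invariants ρ K) := hadm K hK
  let e := invariantsSmoothDualRepEquiv ρ (hopen K hK) hKf
  let WK : Submodule k (invariants (smoothDualRep ρ) K) :=
    W.toSubmodule.comap (invariants (smoothDualRep ρ) K).subtype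
  by_contra haW
  have hlt : WK.map e.toLinearMap < ⊤ := by
    rw [lt_top_iff_ne_top]
    intro htop
    have hmem : e ⟨a, ha⟩ ∈ WK.map e.toLinearMap := htop ▸ Submodule.mem_top
    obtain ⟨b, hb, hba⟩ := hmem
    have hb' : b = ⟨a, ha⟩ := e.injective hba
    rw [hb'] at hb
    exact haW hb
  obtain ⟨F, hF0, hF⟩ := Submodule.exists_le_ker_of_lt_top _ hlt
  obtain ⟨x, hx⟩ := (Module.bijective_dual_eval k (invariants ρ K)).2 F
  have hx0 : x ≠ 0 := by
    rintro rfl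
    apply hF0
    rw [← hx, map_zero]
  have hkill : ∀ w ∈ W, ((w : SmoothDualSpace ρ).val : Module.Dual k V) x = 0 := by
    intro w hw
    haveI : (stabilizerIn (smoothDualRep ρ) K w).FiniteIndex :=
      finiteIndex_stabilizerIn_of_isOpen_of_isCompact (hcpt K hK) (isSmooth_smoothDualRep ρ w)
    rw [← levelAverage_val_apply_of_mem_invariants ρ (hcpt K hK) w x.2]
    set b : invariants (smoothDualRep ρ) K :=
      ⟨levelAverage (smoothDualRep ρ) K w, levelAverage_mem_invariants⟩ with hb
    have hbW : b ∈ WK := levelAverage_mem_of_mem (smoothDualRep ρ) W hw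
    have h1 : e b ∈ WK.map e.toLinearMap := ⟨b, hbW, rfl⟩
    have h2 := hF h1
    rw [LinearMap.mem_ker, ← hx, Module.Dual.eval_apply, invariantsSmoothDualRepEquiv_apply] at h2
    exact h2
  have hxann : (x : V) ∈ ann ρ W := hkill
  rw [h, Submodule.mem_bot] at hxann
  exact hx0 (Subtype.ext hxann)

/-- `π̃ ≠ 0` when `π ≠ 0` (smooth `ρ`, `𝒦` open with `KFinite`, cofinal). -/
theorem nontrivial_smoothDualSpace [Nontrivial V] (hρ : IsSmooth ρ) {𝒦 : Set (Subgroup G)}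
    (hopen : ∀ K ∈ 𝒦, IsOpen (K : Set G)) (hcpt : ∀ K ∈ 𝒦, IsCompact (K : Set G))
    (hbasis : ∀ U : Subgroup G, IsOpen (U : Set G) → ∃ K ∈ 𝒦, K ≤ U) :
    Nontrivial (SmoothDualSpace ρ) := by
  obtain ⟨v, hv⟩ := exists_ne (0 : V)
  obtain ⟨K, hK, hKle⟩ := hbasis _ (hρ v)
  have hvK : v ∈ invariants ρ K := by
    rw [mem_invariants_iff]
    intro g hg
    exact mem_stabilizer_iff.mp (hKle hg)
  obtain ⟨l, hl, hlv⟩ := exists_smoothDualInvariants_apply_ne_zero ρ (hopen K hK)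
    (kFinite_of_isSmooth hρ (hcpt K hK)) hvK hv
  refine ⟨⟨⟨⟨l, ((mem_smoothDualInvariants_iff (ρ := ρ)).mp hl).2⟩⟩, 0, fun h0 => hlv ?_⟩⟩
  have := congrArg (fun b : SmoothDualSpace ρ => (b.val : Module.Dual k V) v) h0
  simpa using this

/-- THE THEOREM: the smooth dual of an irreducible smooth admissible representation is irreducible
(`𝒦` compact open subgroups cofinal among the open subgroups, `ρ` admissible along `𝒦`,
characteristic `0`). -/
theorem isIrreducible_smoothDualRep [ρ.IsIrreducible] (hρ : IsSmooth ρ) {𝒦 : Set (Subgroup G)}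
    (hopen : ∀ K ∈ 𝒦, IsOpen (K : Set G)) (hcpt : ∀ K ∈ 𝒦, IsCompact (K : Set G))
    (hbasis : ∀ U : Subgroup G, IsOpen (U : Set G) → ∃ K ∈ 𝒦, K ≤ U) (hadm : IsAdmissible ρ 𝒦) :
    (smoothDualRep ρ).IsIrreducible := by
  haveI hV : Nontrivial V := by
    by_contra hV
    rw [not_nontrivial_iff_subsingleton] at hV
    have : (⊥ : Subrepresentation ρ) = ⊤ :=
      Subrepresentation.toSubmodule_injective (Subsingleton.elim _ _)
    exact bot_ne_top this
  haveI := nontrivial_smoothDualSpace ρ hρ hopen hcpt hbasis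
  haveI : Nontrivial (Subrepresentation (smoothDualRep ρ)) := by
    refine ⟨⟨⊥, ⊤, fun h => ?_⟩⟩
    obtain ⟨a, ha⟩ := exists_ne (0 : SmoothDualSpace ρ)
    have : a ∈ (⊥ : Subrepresentation (smoothDualRep ρ)) := h ▸ (Submodule.mem_top (x := a))
    exact ha ((Submodule.mem_bot k).mp this)
  exact ⟨fun W => by
    rcases eq_bot_or_eq_top (annSub ρ W) with h | h
    · right
      exact eq_top_of_ann_eq_bot ρ hρ hopen hcpt hbasis hadm W (congrArg Subrepresentation.toSubmodule h)
    · left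
      exact eq_bot_of_ann_eq_top ρ W (congrArg Subrepresentation.toSubmodule h)⟩

end Annihilator

section MathlibPackaging

variable (ρ : Representation k G V) [CharZero k]

/-- `π ≅ π̃̃` as Mathlib's `Representation.Equiv` (T5-60's `doubleDualEquiv` with its equivariance). -/
def doubleDualRepEquiv (hρ : IsSmooth ρ) {𝒦 : Set (Subgroup G)}
    (hopen : ∀ K ∈ 𝒦, IsOpen (K : Set G)) (hcpt : ∀ K ∈ 𝒦, IsCompact (K : Set G))
    (hbasis : ∀ U : Subgroup G, IsOpen (U : Set G) → ∃ K ∈ 𝒦, K ≤ U) (hadm : IsAdmissible ρ 𝒦) :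
    ρ.Equiv (smoothDualRep (smoothDualRep ρ)) :=
  Representation.Equiv.mk (doubleDualEquiv ρ hρ hopen hcpt hbasis hadm) fun g =>
    LinearMap.ext fun v => by
      simp only [LinearMap.comp_apply, LinearEquiv.coe_coe]
      exact doubleDualEquiv_apply_rep ρ hρ hopen hcpt hbasis hadm g v

/-- The canonical map `π → π̃̃` as Mathlib's `IntertwiningMap` (smooth `ρ`). -/
def toDoubleDualIntertwining (hρ : IsSmooth ρ) :
    Representation.IntertwiningMap ρ (smoothDualRep (smoothDualRep ρ)) :=
  LinearMap.intertwiningMap_of_isIntertwiningMap ρ (smoothDualRep (smoothDualRep ρ))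
    (f := toDoubleDual ρ hρ) (toDoubleDual_apply_rep ρ hρ)

end MathlibPackaging

end

end Summit.Ventures.HodgeRepro2.T5SmoothDualIrreducible
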